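import Mathlib

/-!
# Small model: the pointwise ⇒ uniform ignition SCHEMA is not formal

`Sparks.UniformIgnition` (stmt-AnomalousDissipation-14547) has the shape

  (∀ V ∈ D ∩ B̄(U₀,δ₁), ∃ q Tb ν₀ δ > 0, ∀ ν < ν₀, ∀ x ∈ B̄(V,δ), q ≤ burn ν Tb x)
    → ∃ q Tb ν₀ > 0, ∀ ν < ν₀, ∀ x ∈ B̄(U₀,δ₂), q ≤ burn ν Tb x            (0 < δ₂ < δ₁)

with D = smooth div-free fields (dense, meagre in L²), x = finite-energy Leray–Hopf data and
`burn ν Tb x = ν ∫₀^{Tb} ‖∇u‖₂²`.  The theorem below shows that this implication is FALSE for a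
general burn functional already in the one-dimensional model `X = ℝ`, `D = ℚ` (dense and meagre,
like the smooth data), `burn ν Tb x = |x − a|` with `a = √2 − 1` irrational, `U₀ = 0`, `δ₁ = 2`,
`δ₂ = 1`: every rational `V` ignites with radius and quantum `|V − a|/2 > 0`, but the burn vanishes
at the "rough" datum `a ∈ B̄(0,1)`.  The burn here is even continuous in `x` and independent of
`(ν, Tb)`, so neither lower semicontinuity of the burn nor monotonicity in the window rescues the
schema.  Consequence for provers: any proof of `UniformIgnition` must use Navier–Stokes-specific
structure (what prevents the ignition radii `δ_V` from degenerating towards a rough datum); no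
covering/compactness argument over the smooth data can work.  [folklore]
-/

namespace Summit.AnomalousDissipation.AnomalousDissipation.Theorems.UniformIgnition.Negative

/-- The abstract pointwise-to-uniform ignition schema behind `Sparks.UniformIgnition` fails in the
model `X = ℝ`, smooth data `= ℚ`, `burn ν Tb x = |x - (√2 - 1)|`. [folklore] -/
theorem uniformIgnition_schema_false :
    ¬ (∀ (burn : ℝ → ℝ → ℝ → ℝ) (U₀ δ₁ δ₂ : ℝ), 0 < δ₂ → δ₂ < δ₁ →
        (∀ V : ℚ, |(V : ℝ) - U₀| ≤ δ₁ → ∃ q Tb ν₀ δ : ℝ, 0 < q ∧ 0 < Tb ∧ 0 < ν₀ ∧ 0 < δ ∧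
            ∀ ν x : ℝ, 0 < ν → ν < ν₀ → |x - V| ≤ δ → q ≤ burn ν Tb x) →
        ∃ q Tb ν₀ : ℝ, 0 < q ∧ 0 < Tb ∧ 0 < ν₀ ∧
            ∀ ν x : ℝ, 0 < ν → ν < ν₀ → |x - U₀| ≤ δ₂ → q ≤ burn ν Tb x) := by
  intro h
  set a : ℝ := Real.sqrt 2 - 1 with ha_def
  have hirr : Irrational a := by
    simpa [ha_def] using irrational_sqrt_two.sub_natCast 1
  have hs := Real.sq_sqrt (show (0 : ℝ) ≤ 2 by norm_num)
  have hs0 := Real.sqrt_nonneg 2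
  have ha0 : 0 ≤ a := by
    rw [ha_def]; nlinarith
  have ha1 : a ≤ 1 := by
    rw [ha_def]; nlinarith
  -- pointwise ignition at every rational V: radius and quantum |V - a| / 2
  have hyp : ∀ V : ℚ, |(V : ℝ) - 0| ≤ 2 → ∃ q Tb ν₀ δ : ℝ, 0 < q ∧ 0 < Tb ∧ 0 < ν₀ ∧ 0 < δ ∧
      ∀ ν x : ℝ, 0 < ν → ν < ν₀ → |x - V| ≤ δ → q ≤ (fun (_ _ x : ℝ) => |x - a|) ν Tb x := by
    intro V _
    have hVa : (V : ℝ) ≠ a := fun hV => hirr ⟨V, hV⟩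
    have hpos : 0 < |(V : ℝ) - a| := abs_pos.mpr (sub_ne_zero.mpr hVa)
    refine ⟨|(V : ℝ) - a| / 2, 1, 1, |(V : ℝ) - a| / 2, by positivity, one_pos, one_pos,
      by positivity, ?_⟩
    intro ν x _ _ hx
    have htri : |(V : ℝ) - a| ≤ |x - a| + |x - V| := by
      calc |(V : ℝ) - a| = |(x - a) - (x - V)| := by ring_nf
        _ ≤ |x - a| + |x - V| := abs_sub _ _
    show |(V : ℝ) - a| / 2 ≤ |x - a|
    linarith
  obtain ⟨q, Tb, ν₀, hq, _hTb, hν₀, hall⟩ :=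
    h (fun _ _ x => |x - a|) 0 2 1 one_pos (by norm_num) hyp
  -- but the burn vanishes at the rough datum a ∈ B̄(0, 1)
  have hmem : |a - 0| ≤ 1 := by
    rw [sub_zero, abs_of_nonneg ha0]; exact ha1
  have := hall (ν₀ / 2) a (by positivity) (by linarith) hmem
  simp at this
  linarith
end Summit.AnomalousDissipation.AnomalousDissipation.Theorems.UniformIgnition.Negative
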